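import Summits.Parity.GeneralizedHardyLittlewood.Theorems.FordMaynardSieveConst01651SieveConst01651RectPhiBounds
import Summits.Parity.GeneralizedHardyLittlewood.Theorems.FordMaynardSieveConst01651SieveConst01651RectBracketsIco
import HarnessLib

/-!
# Route `FordMaynardSieveConst01651`, target `SieveConst01651` (stmt-Parity-19185), stub `stub_certValuePos` (R2):
# one rectangle of the checker is sound

Def-free helper file (step (6) of the `certP`/`certN` soundness, see `…CertAssembly`): for a grid rectangle
`r = (u₀, u₁, v₀, v₁)` with `0 < u₀ ≤ u₁`, `0 < v₀ ≤ v₁`, `u₁ + v₁ ≤ 60000`, `39616 ≤ u₀ + v₀` and `σ > 0`,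

  `rectPos certBlockLo c σ r / D ≤ (c/10⁶/σ) · ∫∫_{[u₀,u₁)×[v₀,v₁) /J} Φ₆(1−y₁−y₂)/(y₁y₂)`      (`rectPos_sound`),
  `(c/10⁶/σ) · ∫∫_{[u₀,u₁)×[v₀,v₁) /J} Φ₆(1−y₁−y₂)/(y₁y₂) ≤ rectNeg certBlockHi c σ r / D`      (`rectNeg_sound`),

(`J = 120000`, `D = 2⁴⁰`), from `…RectPhiBounds.phiSix_bounds_on_rect` and `…RectBracketsIco`.  The integrand is
written with the truncation `Ψ(s) = 𝟙[0 ≤ s ≤ 1] Φ₆(1 − s)` (equal to `Φ₆(1−y₁−y₂)` on these rectangles), which is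
globally bounded.

References: folklore.
-/

noncomputable section

open MeasureTheory Set
open scoped Classical
open Literature.NumberTheory.Sieve Literature.NumberTheory.Sieve.FordMaynard
open Literature.Analysis.Convolution

namespace Summit.Parity.GeneralizedHardyLittlewood.FordMaynardSieveConst01651SieveConst01651

/-- The truncated Buchstab weight `Ψ(s) = 𝟙[0 ≤ s ≤ 1]·Φ₆(1 − s)` is measurable and globally bounded. [folklore] -/
theorem truncPhi_measurable_bdd :
    Measurable (fun s : ℝ => if 0 ≤ s ∧ s ≤ 1 then ∑ k ∈ Finset.Icc 1 6, (1 / (k.factorial : ℝ)) *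
      cpow (fun t : ℝ => if (1651 / 10000 : ℝ) < t then 1 / t else 0) k (1 - s) else 0) ∧
    ∃ C : ℝ, ∀ s : ℝ, |(if 0 ≤ s ∧ s ≤ 1 then ∑ k ∈ Finset.Icc 1 6, (1 / (k.factorial : ℝ)) *
      cpow (fun t : ℝ => if (1651 / 10000 : ℝ) < t then 1 / t else 0) k (1 - s) else 0)| ≤ C := by
  have hν : (0 : ℝ) < 1651 / 10000 := by norm_num
  have hΦb := locBdd_buchstabPhi hν 6
  refine ⟨Measurable.ite (measurableSet_Ici.inter measurableSet_Iic)
    (hΦb.measurable.comp (measurable_id.const_sub 1)) measurable_const, ?_⟩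
  obtain ⟨C, hC0, hC⟩ := hΦb.bdd_nonneg 1
  refine ⟨C, fun s => ?_⟩
  split_ifs with h
  · exact hC _ (by rw [abs_le]; constructor <;> linarith [h.1, h.2])
  · rw [abs_zero]; exact hC0

/-- **A positive-entry rectangle is sound.** [folklore] -/
theorem rectPos_sound {u₀ u₁ v₀ v₁ : ℕ} (h0u : 0 < u₀) (hu : u₀ ≤ u₁) (h0v : 0 < v₀) (hv : v₀ ≤ v₁)
    (hhi : u₁ + v₁ ≤ 60000) (hlo : 39616 ≤ u₀ + v₀) (c σ : ℕ) (hσ : 0 < σ) :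
    ((rectPos certBlockLo c σ (u₀, u₁, v₀, v₁) : ℕ) : ℝ) / tabD ≤
      ((c : ℝ) / 1000000 / σ) *
        ∫ y in Set.Ico ((u₀ : ℝ) / tabJ) ((u₁ : ℝ) / tabJ) ×ˢ Set.Ico ((v₀ : ℝ) / tabJ) ((v₁ : ℝ) / tabJ),
          (if 0 ≤ y.1 + y.2 ∧ y.1 + y.2 ≤ 1 then ∑ k ∈ Finset.Icc 1 6, (1 / (k.factorial : ℝ)) *
            cpow (fun t : ℝ => if (1651 / 10000 : ℝ) < t then 1 / t else 0) k (1 - (y.1 + y.2)) else 0) /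
            (y.1 * y.2) ∂((volume : Measure ℝ).prod volume) := by
  have hJ : (tabJ : ℝ) = 120000 := by norm_num [tabJ]
  have hJpos : (0 : ℝ) < tabJ := by rw [hJ]; norm_num
  have hD : (0 : ℝ) < tabD := by norm_num [tabD]
  obtain ⟨hΨm, C, hΨC⟩ := truncPhi_measurable_bdd
  set L : ℝ := ((phiLoRange certBlockLo (tabJ - u₁ - v₁) (tabJ - u₀ - v₀) : ℕ) : ℝ) / tabD with hLdef
  have hL0 : 0 ≤ L := by positivity
  -- the table lower bound holds pointwise on the half-open rectangle
  have hS : ((u₁ : ℝ)) / tabJ = ((u₀ : ℝ) + ((u₁ - u₀ : ℕ) : ℝ)) / tabJ := by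
    rw [Nat.cast_sub hu]; ring
  have hT : ((v₁ : ℝ)) / tabJ = ((v₀ : ℝ) + ((v₁ - v₀ : ℕ) : ℝ)) / tabJ := by
    rw [Nat.cast_sub hv]; ring
  have hLpt : ∀ y ∈ Set.Ico ((u₀ : ℝ) / tabJ) (((u₀ : ℝ) + ((u₁ - u₀ : ℕ) : ℝ)) / tabJ) ×ˢ
      Set.Ico ((v₀ : ℝ) / tabJ) (((v₀ : ℝ) + ((v₁ - v₀ : ℕ) : ℝ)) / tabJ),
      L ≤ (fun s : ℝ => if 0 ≤ s ∧ s ≤ 1 then ∑ k ∈ Finset.Icc 1 6, (1 / (k.factorial : ℝ)) *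
        cpow (fun t : ℝ => if (1651 / 10000 : ℝ) < t then 1 / t else 0) k (1 - s) else 0) (y.1 + y.2) := by
    intro y hy
    rw [← hS, ← hT] at hy
    have hb := (phiSix_bounds_on_rect hu hv hhi hlo hy).1
    obtain ⟨⟨hy1a, hy1b⟩, ⟨hy2a, hy2b⟩⟩ := hy
    have hs0 : 0 ≤ y.1 + y.2 := by
      have : (0 : ℝ) ≤ (u₀ : ℝ) / tabJ := by positivity
      have : (0 : ℝ) ≤ (v₀ : ℝ) / tabJ := by positivity
      linarith
    have hs1 : y.1 + y.2 ≤ 1 := by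
      rw [lt_div_iff₀ hJpos] at hy1b hy2b
      have : ((u₁ : ℝ)) + v₁ ≤ 60000 := by exact_mod_cast hhi
      nlinarith
    simp only [hs0, hs1, and_self, if_true]
    exact hb
  have hrect := rect_integral_ge_Ico hΨm hΨC hJpos (S := u₁ - u₀) (T := v₁ - v₀) h0u h0v hL0 hLpt
  rw [← hS, ← hT] at hrect
  -- the checker's value is below the real bracket
  have hval : ((rectPos certBlockLo c σ (u₀, u₁, v₀, v₁) : ℕ) : ℝ) ≤
      (c : ℝ) * ((phiLoRange certBlockLo (tabJ - u₁ - v₁) (tabJ - u₀ - v₀) : ℕ) : ℝ) *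
        (4 * ((u₁ - u₀ : ℕ) : ℝ) * ((v₁ - v₀ : ℕ) : ℝ)) /
        (1000000 * ((2 * (u₀ : ℝ) + ((u₁ - u₀ : ℕ) : ℝ)) * (2 * (v₀ : ℝ) + ((v₁ - v₀ : ℕ) : ℝ))) * σ) := by
    have h := Nat.cast_div_le (α := ℝ) (m := c * phiLoRange certBlockLo (120000 - u₁ - v₁) (120000 - u₀ - v₀) *
      (4 * (u₁ - u₀) * (v₁ - v₀))) (n := 1000000 * ((2 * u₀ + (u₁ - u₀)) * (2 * v₀ + (v₁ - v₀))) * σ)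
    unfold rectPos
    simp only [tabJ]
    push_cast at h ⊢
    exact h
  have hσr : (0 : ℝ) < σ := by exact_mod_cast hσ
  have hden : (0 : ℝ) < (2 * (u₀ : ℝ) + ((u₁ - u₀ : ℕ) : ℝ)) * (2 * (v₀ : ℝ) + ((v₁ - v₀ : ℕ) : ℝ)) := by positivity
  calc ((rectPos certBlockLo c σ (u₀, u₁, v₀, v₁) : ℕ) : ℝ) / tabD
      ≤ (c : ℝ) * ((phiLoRange certBlockLo (tabJ - u₁ - v₁) (tabJ - u₀ - v₀) : ℕ) : ℝ) *
        (4 * ((u₁ - u₀ : ℕ) : ℝ) * ((v₁ - v₀ : ℕ) : ℝ)) /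
        (1000000 * ((2 * (u₀ : ℝ) + ((u₁ - u₀ : ℕ) : ℝ)) * (2 * (v₀ : ℝ) + ((v₁ - v₀ : ℕ) : ℝ))) * σ) / tabD :=
        div_le_div_of_nonneg_right hval hD.le
    _ = ((c : ℝ) / 1000000 / σ) * (L * ((2 : ℝ) * ((u₁ - u₀ : ℕ) : ℝ) / (2 * u₀ + ((u₁ - u₀ : ℕ) : ℝ))) *
        ((2 : ℝ) * ((v₁ - v₀ : ℕ) : ℝ) / (2 * v₀ + ((v₁ - v₀ : ℕ) : ℝ)))) := by
        rw [hLdef]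
        field_simp
        ring
    _ ≤ ((c : ℝ) / 1000000 / σ) * _ := mul_le_mul_of_nonneg_left hrect (by positivity)

/-- **A negative-entry rectangle is sound.** [folklore] -/
theorem rectNeg_sound {u₀ u₁ v₀ v₁ : ℕ} (h0u : 0 < u₀) (hu : u₀ ≤ u₁) (h0v : 0 < v₀) (hv : v₀ ≤ v₁)
    (hhi : u₁ + v₁ ≤ 60000) (hlo : 39616 ≤ u₀ + v₀) (c σ : ℕ) (hσ : 0 < σ) :
    ((c : ℝ) / 1000000 / σ) *
        ∫ y in Set.Ico ((u₀ : ℝ) / tabJ) ((u₁ : ℝ) / tabJ) ×ˢ Set.Ico ((v₀ : ℝ) / tabJ) ((v₁ : ℝ) / tabJ),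
          (if 0 ≤ y.1 + y.2 ∧ y.1 + y.2 ≤ 1 then ∑ k ∈ Finset.Icc 1 6, (1 / (k.factorial : ℝ)) *
            cpow (fun t : ℝ => if (1651 / 10000 : ℝ) < t then 1 / t else 0) k (1 - (y.1 + y.2)) else 0) /
            (y.1 * y.2) ∂((volume : Measure ℝ).prod volume) ≤
      ((rectNeg certBlockHi c σ (u₀, u₁, v₀, v₁) : ℕ) : ℝ) / tabD := by
  have hJ : (tabJ : ℝ) = 120000 := by norm_num [tabJ]
  have hJpos : (0 : ℝ) < tabJ := by rw [hJ]; norm_num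
  have hD : (0 : ℝ) < tabD := by norm_num [tabD]
  obtain ⟨hΨm, C, hΨC⟩ := truncPhi_measurable_bdd
  set U : ℝ := ((phiHiRange certBlockHi (tabJ - u₁ - v₁) (tabJ - u₀ - v₀) : ℕ) : ℝ) / tabD with hUdef
  have hU0 : 0 ≤ U := by positivity
  have hS : ((u₁ : ℝ)) / tabJ = ((u₀ : ℝ) + ((u₁ - u₀ : ℕ) : ℝ)) / tabJ := by
    rw [Nat.cast_sub hu]; ring
  have hT : ((v₁ : ℝ)) / tabJ = ((v₀ : ℝ) + ((v₁ - v₀ : ℕ) : ℝ)) / tabJ := by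
    rw [Nat.cast_sub hv]; ring
  have hUpt : ∀ y ∈ Set.Ico ((u₀ : ℝ) / tabJ) (((u₀ : ℝ) + ((u₁ - u₀ : ℕ) : ℝ)) / tabJ) ×ˢ
      Set.Ico ((v₀ : ℝ) / tabJ) (((v₀ : ℝ) + ((v₁ - v₀ : ℕ) : ℝ)) / tabJ),
      (fun s : ℝ => if 0 ≤ s ∧ s ≤ 1 then ∑ k ∈ Finset.Icc 1 6, (1 / (k.factorial : ℝ)) *
        cpow (fun t : ℝ => if (1651 / 10000 : ℝ) < t then 1 / t else 0) k (1 - s) else 0) (y.1 + y.2) ≤ U := by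
    intro y hy
    rw [← hS, ← hT] at hy
    have hb := (phiSix_bounds_on_rect hu hv hhi hlo hy).2
    obtain ⟨⟨hy1a, hy1b⟩, ⟨hy2a, hy2b⟩⟩ := hy
    have hs0 : 0 ≤ y.1 + y.2 := by
      have : (0 : ℝ) ≤ (u₀ : ℝ) / tabJ := by positivity
      have : (0 : ℝ) ≤ (v₀ : ℝ) / tabJ := by positivity
      linarith
    have hs1 : y.1 + y.2 ≤ 1 := by
      rw [lt_div_iff₀ hJpos] at hy1b hy2b
      have : ((u₁ : ℝ)) + v₁ ≤ 60000 := by exact_mod_cast hhi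
      nlinarith
    simp only [hs0, hs1, and_self, if_true]
    exact hb
  have hrect := rect_integral_le_Ico hΨm hΨC hJpos (S := u₁ - u₀) (T := v₁ - v₀) h0u h0v hU0 hUpt
  rw [← hS, ← hT] at hrect
  have hσr : (0 : ℝ) < σ := by exact_mod_cast hσ
  have hu0r : (0 : ℝ) < u₀ := by exact_mod_cast h0u
  have hv0r : (0 : ℝ) < v₀ := by exact_mod_cast h0v
  -- the real bracket is below the checker's ceiling
  have hE : 0 < 1000000 * (4 * (u₀ * v₀) * ((u₀ + (u₁ - u₀)) * (v₀ + (v₁ - v₀)))) * σ := by positivity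
  have hceil := le_mul_ceilDiv (c * phiHiRange certBlockHi (120000 - u₁ - v₁) (120000 - u₀ - v₀) *
      ((u₁ - u₀) * (v₁ - v₀) * ((2 * u₀ + (u₁ - u₀)) * (2 * v₀ + (v₁ - v₀))))) hE
  have hceil' : (c : ℝ) * ((phiHiRange certBlockHi (tabJ - u₁ - v₁) (tabJ - u₀ - v₀) : ℕ) : ℝ) *
      (((u₁ - u₀ : ℕ) : ℝ) * ((v₁ - v₀ : ℕ) : ℝ) * ((2 * (u₀ : ℝ) + ((u₁ - u₀ : ℕ) : ℝ)) *
        (2 * (v₀ : ℝ) + ((v₁ - v₀ : ℕ) : ℝ)))) ≤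
      (1000000 * (4 * ((u₀ : ℝ) * v₀) * (((u₀ : ℝ) + ((u₁ - u₀ : ℕ) : ℝ)) * ((v₀ : ℝ) + ((v₁ - v₀ : ℕ) : ℝ)))) * σ) *
        ((rectNeg certBlockHi c σ (u₀, u₁, v₀, v₁) : ℕ) : ℝ) := by
    unfold rectNeg cdiv
    simp only [tabJ]
    exact_mod_cast hceil
  have hden : (0 : ℝ) < 1000000 * (4 * ((u₀ : ℝ) * v₀) * (((u₀ : ℝ) + ((u₁ - u₀ : ℕ) : ℝ)) *
      ((v₀ : ℝ) + ((v₁ - v₀ : ℕ) : ℝ)))) * σ := by positivity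
  calc ((c : ℝ) / 1000000 / σ) * _ ≤ ((c : ℝ) / 1000000 / σ) * (U * (((u₁ - u₀ : ℕ) : ℝ) *
        (2 * u₀ + ((u₁ - u₀ : ℕ) : ℝ)) / (2 * u₀ * (u₀ + ((u₁ - u₀ : ℕ) : ℝ)))) *
        (((v₁ - v₀ : ℕ) : ℝ) * (2 * v₀ + ((v₁ - v₀ : ℕ) : ℝ)) / (2 * v₀ * (v₀ + ((v₁ - v₀ : ℕ) : ℝ))))) :=
        mul_le_mul_of_nonneg_left hrect (by positivity)
    _ = ((c : ℝ) * ((phiHiRange certBlockHi (tabJ - u₁ - v₁) (tabJ - u₀ - v₀) : ℕ) : ℝ) *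
        (((u₁ - u₀ : ℕ) : ℝ) * ((v₁ - v₀ : ℕ) : ℝ) * ((2 * (u₀ : ℝ) + ((u₁ - u₀ : ℕ) : ℝ)) *
          (2 * (v₀ : ℝ) + ((v₁ - v₀ : ℕ) : ℝ)))) /
        (1000000 * (4 * ((u₀ : ℝ) * v₀) * (((u₀ : ℝ) + ((u₁ - u₀ : ℕ) : ℝ)) * ((v₀ : ℝ) + ((v₁ - v₀ : ℕ) : ℝ)))) * σ))
        / tabD := by
        rw [hUdef]
        field_simp
        ring
    _ ≤ ((rectNeg certBlockHi c σ (u₀, u₁, v₀, v₁) : ℕ) : ℝ) / tabD := by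
        apply div_le_div_of_nonneg_right _ hD.le
        rw [div_le_iff₀ hden]
        linarith [hceil']

end Summit.Parity.GeneralizedHardyLittlewood.FordMaynardSieveConst01651SieveConst01651

end
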